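import Literature.AlgebraicGeometry.Surfaces.LatticePolarizedK3Fibration
import Literature.AlgebraicGeometry.HodgeTheory.KugaSatakeClassBetti
import Literature.AlgebraicGeometry.HodgeTheory.GlobalInvariantCycles
import Literature.AlgebraicGeometry.Motives.FamiliesVHS
import Literature.AlgebraicGeometry.Motives.MotivatedPeriodTorsor
import Literature.AlgebraicGeometry.HodgeTheory.HodgeConjecture
import Literature.AlgebraicGeometry.Motives.VeryGeneralComplexPoint
import Mathlib.Topology.GDelta.Basic
import HarnessLib

/-!
# Hodge classes on all powers of the K3 surfaces of a family of generic Picard number 16 with algebraic Kuga–Satake correspondence (Varesco, Michigan Math. J. 75 (2025), Thm. 0.2 = Thm. 4.3), and the specialisation principle "algebraicity of all Hodge classes on all powers passes to a special fibre with `End_Hdg T = ℚ`" (ibid. Cor. 2.23) — NAMED FACTS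

Family `hodge`, layer `Literature/AlgebraicGeometry/Surfaces`. Consumers BY NAME: cell `hodge-nonav`
(planner memo ROUTE-P1J §8 (d); the knowledge map of the non-abelian Hodge ladder) and the K3-square
routes `HodgeConjecture/ELineTransport` (crux `PicardSixteen`: "known only for the two 4-dimensional
families with algebraic Kuga–Satake correspondence (Varesco2025 Thm 0.2)") and
`HodgeConjecture/MarkmanPartnerTransport` (`ρ(S) = 16 (Varesco2025)`), which so far could cite the
theorem only in prose: the tree's Varesco record `K3PowersHodgeOfSquare` types §2 (Ramón Marí, CM
powers) and lists "Thm. 4.3 (Picard number 16)" and "Prop. 2.22" under "What is NOT here".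

## Source (read at source; locators = files of the materialised arXiv text `paper:arxiv-2203.09778`, arXiv numbering = journal numbering)

M. Varesco, *The Hodge conjecture for powers of K3 surfaces of Picard number 16*, Michigan Math. J. 75
(2025), no. 5, doi:10.1307/mmj/20236349 = arXiv:2203.09778 [`Varesco2025`; REFEREED]. Verbatim (the
bracket `[statement]` replaces the name of the summit statement, which a record's docstring may not
spell):

* Introduction §0.2, **Theorem 0.2** (= §4 **Theorem 4.3**, [p0003:L21–L29] = [p0021:L54–L62]): "Let
  `𝒳 → S` be a four-dimensional family of K3 surfaces whose general fibre is of Picard number `16`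
  with an isometry `T(𝒳_s) ≃ U_ℚ² ⊕ ⟨a⟩ ⊕ ⟨b⟩`, for some negative integers `a` and `b`. If the
  Kuga–Satake correspondence is algebraic for the fibres of this family, then the Hodge [statement]
  holds for all powers of every K3 surface in this family."  [p0003:L31]: "At the time of us writing
  this article, there are two families of K3 surfaces which satisfy the hypotheses of Theorem 0.2:
  The family of double covers of `ℙ²` branched along six lines studied in [Schlickewei 2010] and the
  family of K3 surfaces which are desingularization of singular K3 surfaces in `ℙ⁴` with `15` simple
  nodes studied in [Ingalls–Logan–Patashnick]. In particular, Theorem 0.2 proves the Hodge [statement]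
  for all powers of the K3 surfaces in these families."  Printed proof of Thm. 4.3 [p0021:L64 –
  p0022:L9]: for every `s ∈ S` the pair `(dim T(𝒳_s), E = End_Hdg(T(𝒳_s)))` is (i) `E` CM — Cor. 2.3
  (Ramón Marí + Buskin/Huybrechts; the tree's `RamonMari2008_hodgeClasses_algebraic_K3Powers_of_square_of_CM`);
  (ii) `dim T = 6`, `E = ℚ` — Thm. 4.1 (Lombardo: `KS(𝒳_s) ∼ A⁴`, `A` a general abelian fourfold of
  Weil type with discriminant one), Thm. 3.10 (Markman) and Thm. 3.16 (Abdulali: powers of a general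
  abelian variety of Weil type), then Lemma 1.7 (algebraic Kuga–Satake correspondence transfers
  algebraicity); (iii) `dim T = 6`, `E` real quadratic — Thm. 3.18 (definite quaternionic
  multiplication); (iv) `dim T ≤ 5`, `E = ℚ` — the degeneration result Cor. 2.23.
* §2.4 **Proposition 2.22** [p0013:L47–L50]: "Let `𝒳 → S` be a family of K3 surfaces such that
  `det T(𝒳_s)` is algebraic for general `s ∈ S`. Then, the same holds for all `s ∈ S`."
  **Corollary 2.23** [p0014:L15–L18]: "Let `𝒳 → S` be a family of K3 surfaces such that the Hodge
  [statement] for all powers of `𝒳_s` holds for general `s ∈ S`. If `0 ∈ S` is an element such that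
  `End_{Hdg(𝒳_0)}(T(𝒳_0)) = ℚ`, then the Hodge [statement] holds for all powers of `𝒳_0`."  (Proof:
  Prop. 2.22 + Thm. 2.16: for `E = ℚ` every Hodge class in `⨂ T(𝒳_0)` is expressed through the class of
  the diagonal and `det T(𝒳_0)`.)  Remark 2.24: the hypothesis may be weakened to
  `End_Hdg(T(𝒳_0)) = End_Hdg(T(𝒳_s))` ("We do not give here the detailed proof" — NOT recorded).
* §4 **Example 4.4** [p0022:L12–L18] (double covers of `ℙ²` branched along six lines no three
  concurrent, blown up in the `15` nodes: general Picard number `16`, `T ≅ U_ℚ² ⊕ ⟨−2⟩²` [Paranjape],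
  Kuga–Satake correspondence constructed by Paranjape; "Our Theorem 4.3 then extends the result in
  [Schlickewei 2010], since it allows us to conclude that the Hodge [statement] holds for all powers of
  the K3 surfaces in this family and not just for their square") and **Example 4.5** [p0022:L19–L25]
  (desingularised `15`-nodal K3 surfaces in `ℙ⁴`: `T ≅ U_ℚ² ⊕ ⟨−6⟩ ⊕ ⟨−2⟩`, Kuga–Satake algebraic by
  Ingalls–Logan–Patashnick).

## Rendering (tree carriers) and faithfulness

* "family of K3 surfaces `𝒳 → S`": a morphism `f : 𝒳 ⟶ S` of `ℂ`-schemes which is a smooth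
  projective family of relative dimension `2` (`Motives.IsSmoothProjectiveFamily f 2`) over a base `S`
  that is quasi-projective (`HodgeTheory.IsQuasiProjectiveOver`), irreducible (`IrreducibleSpace`) and
  smooth over `ℂ` of dimension `4` (`SmoothOfRelativeDimension 4 S.hom` — the printed
  "four-dimensional"; the proof uses only that the family is an algebraic family over an irreducible
  base, so this clause makes the record WEAKER than what is proved, never stronger), all of whose
  complex fibres `𝒳_s = Motives.fiberOver f s`, `s ∈ S(ℂ)`, are K3 surfaces (`IsK3Surface`).
* "general fibre … Picard number `16` with an isometry `T(𝒳_s) ≃ U_ℚ² ⊕ ⟨a⟩ ⊕ ⟨b⟩`": for all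
  `s ∈ S(ℂ)` off a COUNTABLE family of PROPER Zariski-closed subsets of `S` (the Noether–Lefschetz
  reading of "general", under which the Picard number is constant; as a HYPOTHESIS this is the weakest
  reading, so the record is at most as strong as the print): `dim_ℂ N¹H²(𝒳_s(ℂ); ℂ) = 16`
  (`Module.finrank ℂ (algebraicClasses _ 1)`, the spelling of `K3RealMultiplicationCycleInduced`) and
  `T(𝒳_s) ⊗ ℚ ≅ U_ℚ² ⊕ ⟨a⟩ ⊕ ⟨b⟩` as rational quadratic spaces, spelled WITHOUT a choice of sign for
  `H⁴`: there are an integral generator `p` of `H⁴(𝒳_s(ℂ); ℂ)` and RATIONAL classes `t₀, …, t₅`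
  forming a `ℂ`-basis of `transcendentalSubspace (𝒳_s)` (`= NS^⊥ ⊗ ℂ`, file
  `LatticePolarizedK3Fibration`) with `tᵢ ∪ tⱼ = G(a,b)ᵢⱼ · p`, `G(a,b) = U ⊕ U ⊕ ⟨a⟩ ⊕ ⟨b⟩`
  (`picardSixteenGram a b`). Since the intersection form on `T` has signature `(2, 4)` and `a, b < 0`,
  only the orientation generator `p` can satisfy this, so no orientation convention enters (the device
  of `Floccari2026_hodgeClasses_algebraic_powers_of_K3_of_transcendental_embedding`).
* "the Kuga–Satake correspondence is algebraic for the fibres": the tree's surface predicate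
  `HodgeTheory.IsKSCorrespondenceAlgebraicBetti` (Floccari's (3.3)/Rem. 3.4 = Varesco's Conj. 1.6 in
  `H²_tr`-form, van Geemen 2000 §10) for EVERY complex fibre.
* "the Hodge [statement] holds for all powers of every K3 surface in this family": `∀ s k,
  HodgeTheory.HodgeConjectureFor (k * 2) (Motives.SchemeOver.pow (fiberOver f s) k)` — the spelling
  of the tree's K3-powers records (`Floccari2026_…_powers_…`, `RamonMari2008_…`).
* Cor. 2.23: same family carrier (any dimension of the base: "a family of K3 surfaces"); "holds for
  general `s`" = for all `s` off a countable family of proper closed subsets (Varesco's proof of Prop.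
  2.22 fixes the generic transcendental lattice `T̃`, constant exactly off the Noether–Lefschetz locus,
  and specialises algebraic classes from those fibres); "`End_{Hdg(𝒳_0)}(T(𝒳_0)) = ℚ`": every
  `ℂ`-linear endomorphism of `H²(𝒳_0(ℂ); ℂ)` mapping `T ⊗ ℂ` into itself, rational classes of `T` to
  rational classes and preserving Hodge types on `T` acts on `T ⊗ ℂ` as a RATIONAL SCALAR
  (`HasRationalTranscendentalEndomorphismsOnly`; = `End_Hdg(T_ℚ) = ℚ · id`).

## Content and D-0026 accounting

Definitions (real): `picardSixteenGram`, `HasTranscendentalLatticeU2ab` (the sign-free spelling of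
`T(X) ⊗ ℚ ≅ U_ℚ² ⊕ ⟨a⟩ ⊕ ⟨b⟩`), `IsK3Family` (the family carrier, bundling the clauses above),
`IsVeryGeneralIn` ("off a countable family of proper closed subsets"),
`HasRationalTranscendentalEndomorphismsOnly`; unfolding lemmas; `IsVeryGeneralIn.of_forall` (a property
holding everywhere holds very generally). TWO named facts (+2; refereed theorems cited at the line;
`lean search 'Varesco2025|Picard number 16|PicardSixteen|six lines'` in `Literature/` finds only
`K3PowersHodgeOfSquare` (§2, CM) with Thm. 4.3 / Prop. 2.22 in its "NOT here" list):
`Varesco2025_hodgeClasses_algebraic_powers_picardSixteenFamily` (Thm. 0.2 = 4.3) and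
`Varesco2025_hodgeClasses_algebraic_powers_specialisation` (Cor. 2.23).

## Not here

Examples 4.4 / 4.5 as statements about double sextic planes / `15`-nodal quartic K3 surfaces (no
double-cover or nodal-surface vocabulary in the tree: the record applies to those families once they
are constructed as `IsK3Family` with Paranjape's / Ingalls–Logan–Patashnick's Kuga–Satake cycles);
Thm. 2.16 and the exceptional classes `⋀ʳ_E T(X)`; Prop. 2.22 by itself (`det T(X)` has no carrier
yet); Remark 2.24; §3 (abelian varieties of Weil type: Thms. 3.16/3.18 after Abdulali, Prop. 4.2);
any proof of the two facts.

## References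

* [Varesco2025] M. Varesco, The Hodge conjecture for powers of K3 surfaces of Picard number 16,
  Michigan Math. J. 75 (2025) no. 5 = arXiv:2203.09778: Thm. 0.2 (§0.2), Lemma 1.7, Cor. 2.3, Thm. 2.16,
  Prop. 2.22, Cor. 2.23, Rem. 2.24, Thm. 4.1, Prop. 4.2, Thm. 4.3, Examples 4.4–4.5.
* [Schlickewei2010] U. Schlickewei, The Hodge conjecture for self-products of certain K3 surfaces,
  J. Algebra 324 (2010) 507–529.
* [Lombardo2001] G. Lombardo, Abelian varieties of Weil type and Kuga–Satake varieties, Tohoku Math.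
  J. 53 (2001) 453–466.
* K. Paranjape, Abelian varieties associated to certain K3 surfaces, Compositio Math. 68 (1988) 11–22.
-/

noncomputable section

open CategoryTheory MonoidalCategory AlgebraicGeometry
open Literature.AlgebraicTopology.SingularHomology
open Literature.AlgebraicGeometry.HodgeTheory
open Literature.AlgebraicGeometry.Motives (fiberOver IsSmoothProjectiveFamily)

namespace Literature.AlgebraicGeometry.Surfaces

/-! ### The rational quadratic space `U ⊕ U ⊕ ⟨a⟩ ⊕ ⟨b⟩` -/

/-- **The Gram matrix `G(a,b)` of `U ⊕ U ⊕ ⟨a⟩ ⊕ ⟨b⟩`** on the basis `e₀, …, e₅` (`U` the hyperbolic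
plane on `e₀, e₁` and on `e₂, e₃`; `⟨a⟩`, `⟨b⟩` on `e₄`, `e₅`): Varesco's "`U_ℚ² ⊕ ⟨a⟩ ⊕ ⟨b⟩`".
[cite: Varesco2025, Thm. 4.1 and Thm. 4.3 (§4)] -/
def picardSixteenGram (a b : ℤ) : Matrix (Fin 6) (Fin 6) ℤ :=
  !![0, 1, 0, 0, 0, 0;
     1, 0, 0, 0, 0, 0;
     0, 0, 0, 1, 0, 0;
     0, 0, 1, 0, 0, 0;
     0, 0, 0, 0, a, 0;
     0, 0, 0, 0, 0, b]

/-- `G(a,b)` is symmetric. [cite: Varesco2025, Thm. 4.1 (§4)] -/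
theorem picardSixteenGram_transpose (a b : ℤ) : (picardSixteenGram a b).transpose = picardSixteenGram a b := by
  ext i j; fin_cases i <;> fin_cases j <;> rfl

/-- **`T(X) ⊗ ℚ ≅ U_ℚ² ⊕ ⟨a⟩ ⊕ ⟨b⟩` as rational quadratic spaces, sign-free** (module docstring,
"Rendering"): there are an integral generator `p` of `H⁴(X(ℂ); ℂ)` and rational classes `t₀, …, t₅`
forming a `ℂ`-basis of `transcendentalSubspace X = NS(X)^⊥ ⊗ ℂ` with `tᵢ ∪ tⱼ = G(a,b)ᵢⱼ · p`. For
`a, b < 0` (signature `(2,4)`) only the orientation generator `p` qualifies. In particular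
`dim_ℚ T(X) = 6`. [cite: Varesco2025, Thm. 4.3 (§4) (hypothesis on the general fibre)] -/
def HasTranscendentalLatticeU2ab (X : Motives.SchemeOver ℂ) (a b : ℤ) : Prop :=
  ∃ (p : complexBetti X (2 * 2)) (t : Fin 6 → complexBetti X (2 * 1)),
    IsIntegralClass p ∧ (∀ q : complexBetti X (2 * 2), IsIntegralClass q → ∃ n : ℤ, q = n • p) ∧
    (∀ i, t i ∈ transcendentalSubspace X ∧ IsRationalClass (t i)) ∧
    LinearIndependent ℂ t ∧ Submodule.span ℂ (Set.range t) = transcendentalSubspace X ∧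
    ∀ i j, cupProduct (rfl : 2 * 1 + 2 * 1 = 2 * 2) (t i) (t j) = ((picardSixteenGram a b i j : ℤ) : ℂ) • p

/-- Unfolding of `HasTranscendentalLatticeU2ab`. [cite: Varesco2025, Thm. 4.3 (§4)] -/
theorem hasTranscendentalLatticeU2ab_iff (X : Motives.SchemeOver ℂ) (a b : ℤ) :
    HasTranscendentalLatticeU2ab X a b ↔
      ∃ (p : complexBetti X (2 * 2)) (t : Fin 6 → complexBetti X (2 * 1)),
        IsIntegralClass p ∧ (∀ q : complexBetti X (2 * 2), IsIntegralClass q → ∃ n : ℤ, q = n • p) ∧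
        (∀ i, t i ∈ transcendentalSubspace X ∧ IsRationalClass (t i)) ∧
        LinearIndependent ℂ t ∧ Submodule.span ℂ (Set.range t) = transcendentalSubspace X ∧
        ∀ i j, cupProduct (rfl : 2 * 1 + 2 * 1 = 2 * 2) (t i) (t j) =
          ((picardSixteenGram a b i j : ℤ) : ℂ) • p :=
  Iff.rfl

/-- Under `HasTranscendentalLatticeU2ab X a b` the transcendental subspace has complex dimension `6`
(`dim_ℚ T(X) = 6`, `ρ(X) = 22 − 6 = 16` for a K3 surface). [cite: Varesco2025, Thm. 4.3 (§4), proof: "dim T(𝒳_s) = 6"] -/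
theorem HasTranscendentalLatticeU2ab.finrank_transcendentalSubspace {X : Motives.SchemeOver ℂ} {a b : ℤ}
    (h : HasTranscendentalLatticeU2ab X a b) :
    Module.finrank ℂ ↥(transcendentalSubspace X) = 6 := by
  obtain ⟨-, t, -, -, -, hli, hspan, -⟩ := h
  rw [← hspan, finrank_span_eq_card hli, Fintype.card_fin]

/-! ### Families of K3 surfaces and "very general" -/

/-- **A family of K3 surfaces over a smooth irreducible quasi-projective base of dimension `d`**:
`f : 𝒳 ⟶ S` is a smooth projective family of relative dimension `2` (`IsSmoothProjectiveFamily`: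
smooth of relative dimension `2`, proper, with smooth projective fibres), `S` is quasi-projective,
irreducible and smooth over `ℂ` of relative dimension `d`, and every complex fibre `𝒳_s`
(`fiberOver f s`, `s ∈ S(ℂ)`) is a K3 surface. Varesco: "a (four-dimensional) family of K3 surfaces
`𝒳 → S`". [cite: Varesco2025, Thm. 4.3 and Prop. 2.22 (the families 𝒳 → S)]
[cite: VoisinHodgeI2002, §9.1.1 (families)] -/
structure IsK3Family {𝒳 S : Motives.SchemeOver ℂ} (f : 𝒳 ⟶ S) (d : ℕ) : Prop where
  /-- `f` is a smooth projective family of relative dimension `2`. -/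
  isSmoothProjectiveFamily : IsSmoothProjectiveFamily f 2
  /-- The base is quasi-projective over `ℂ` … -/
  isQuasiProjectiveOver : IsQuasiProjectiveOver S
  /-- … irreducible … -/
  irreducibleSpace : IrreducibleSpace S.left
  /-- … and smooth over `ℂ` of dimension `d`. -/
  smoothOfRelativeDimension : SmoothOfRelativeDimension d S.hom
  /-- Every complex fibre is a K3 surface. -/
  isK3Surface : ∀ s : Motives.ComplexPoints S, IsK3Surface (fiberOver f s)

/-- **`P` holds for the VERY GENERAL complex point of `S`**: there is a countable family of proper
Zariski-closed subsets of `S` off which every complex point satisfies `P` (the Noether–Lefschetz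
reading of "general `s ∈ S`" for K3 families: the jumping locus of the Picard number is a countable
union of proper closed subsets). [cite: Varesco2025, Thm. 4.3 ("general fibre") and proof of Prop. 2.22 ("general s ∈ S")]
[cite: VoisinHodgeII2003, §5.3.4 (Noether–Lefschetz locus: a countable union of proper algebraic subsets)] -/
def IsVeryGeneralIn (S : Motives.SchemeOver ℂ) (P : Motives.ComplexPoints S → Prop) : Prop :=
  ∃ 𝒵 : Set (Set S.left), 𝒵.Countable ∧ (∀ Z ∈ 𝒵, IsClosed Z ∧ Z ≠ Set.univ) ∧
    ∀ s : Motives.ComplexPoints S, (∀ Z ∈ 𝒵, s.pt ∉ Z) → P s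

/-- Unfolding of `IsVeryGeneralIn`. [cite: Varesco2025, Thm. 4.3 ("general fibre")] -/
theorem isVeryGeneralIn_iff (S : Motives.SchemeOver ℂ) (P : Motives.ComplexPoints S → Prop) :
    IsVeryGeneralIn S P ↔
      ∃ 𝒵 : Set (Set S.left), 𝒵.Countable ∧ (∀ Z ∈ 𝒵, IsClosed Z ∧ Z ≠ Set.univ) ∧
        ∀ s : Motives.ComplexPoints S, (∀ Z ∈ 𝒵, s.pt ∉ Z) → P s :=
  Iff.rfl

/-- A property of all complex points holds very generally (take no exceptional subsets).
[cite: Varesco2025, Thm. 4.3] -/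
theorem IsVeryGeneralIn.of_forall {S : Motives.SchemeOver ℂ} {P : Motives.ComplexPoints S → Prop}
    (h : ∀ s, P s) : IsVeryGeneralIn S P :=
  ⟨∅, Set.countable_empty, fun _ hZ => (Set.notMem_empty _ hZ).elim, fun s _ => h s⟩

/-- Very general properties are stable under weakening. [cite: Varesco2025, Thm. 4.3] -/
theorem IsVeryGeneralIn.mono {S : Motives.SchemeOver ℂ} {P Q : Motives.ComplexPoints S → Prop}
    (h : IsVeryGeneralIn S P) (hPQ : ∀ s, P s → Q s) : IsVeryGeneralIn S Q := by
  obtain ⟨𝒵, h𝒵, hcl, hP⟩ := h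
  exact ⟨𝒵, h𝒵, hcl, fun s hs => hPQ s (hP s hs)⟩

/-- Two very general properties hold simultaneously very generally (union of the two countable
families of exceptional subsets). [cite: Varesco2025, Thm. 4.3] -/
theorem IsVeryGeneralIn.and {S : Motives.SchemeOver ℂ} {P Q : Motives.ComplexPoints S → Prop}
    (hP : IsVeryGeneralIn S P) (hQ : IsVeryGeneralIn S Q) : IsVeryGeneralIn S fun s => P s ∧ Q s := by
  obtain ⟨𝒵, h𝒵, hcl, h⟩ := hP
  obtain ⟨𝒵', h𝒵', hcl', h'⟩ := hQ
  refine ⟨𝒵 ∪ 𝒵', h𝒵.union h𝒵', fun Z hZ => hZ.elim (hcl Z) (hcl' Z), fun s hs => ⟨?_, ?_⟩⟩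
  · exact h s fun Z hZ => hs Z (Or.inl hZ)
  · exact h' s fun Z hZ => hs Z (Or.inr hZ)

/-- **`End_{Hdg}(T(X) ⊗ ℚ) = ℚ`**: every `ℂ`-linear endomorphism of `H²(X(ℂ); ℂ)` which maps
`T(X) ⊗ ℂ = transcendentalSubspace X` into itself, rational classes of `T(X)` to rational classes,
and classes of Hodge type `(i,j)` in `T(X)` to classes of type `(i,j)` — i.e. whose restriction to
`T(X)` is (the complexification of) a rational Hodge endomorphism of `T(X) ⊗ ℚ` — acts on `T(X) ⊗ ℂ`
as multiplication by a RATIONAL scalar. (Equivalently `TranscendentalEndomorphismsGeneratedBy X 0` of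
`K3RealMultiplicationCycleInduced` in the `N¹`-orthogonal spelling.) Varesco: "an element such that
`End_{Hdg(𝒳_0)}(T(𝒳_0)) = ℚ`". [cite: Varesco2025, Cor. 2.23 (hypothesis) and §0.1]
[cite: Zarhin1983HodgeGroupsK3, Thm. 1.5.1] -/
def HasRationalTranscendentalEndomorphismsOnly (X : Motives.SchemeOver ℂ) : Prop :=
  ∀ φ : complexBetti X (2 * 1) →ₗ[ℂ] complexBetti X (2 * 1),
    Set.MapsTo φ (transcendentalSubspace X) (transcendentalSubspace X) →
    (∀ a ∈ transcendentalSubspace X, IsRationalClass a → IsRationalClass (φ a)) →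
    (∀ (i j : ℕ), ∀ a ∈ transcendentalSubspace X,
      IsOfHodgeType 2 X (2 * 1) i j a → IsOfHodgeType 2 X (2 * 1) i j (φ a)) →
    ∃ q : ℚ, ∀ a ∈ transcendentalSubspace X, φ a = (q : ℂ) • a

/-- Unfolding of `HasRationalTranscendentalEndomorphismsOnly`. [cite: Varesco2025, Cor. 2.23 (hypothesis)] -/
theorem hasRationalTranscendentalEndomorphismsOnly_iff (X : Motives.SchemeOver ℂ) :
    HasRationalTranscendentalEndomorphismsOnly X ↔
      ∀ φ : complexBetti X (2 * 1) →ₗ[ℂ] complexBetti X (2 * 1),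
        Set.MapsTo φ (transcendentalSubspace X) (transcendentalSubspace X) →
        (∀ a ∈ transcendentalSubspace X, IsRationalClass a → IsRationalClass (φ a)) →
        (∀ (i j : ℕ), ∀ a ∈ transcendentalSubspace X,
          IsOfHodgeType 2 X (2 * 1) i j a → IsOfHodgeType 2 X (2 * 1) i j (φ a)) →
        ∃ q : ℚ, ∀ a ∈ transcendentalSubspace X, φ a = (q : ℂ) • a :=
  Iff.rfl

/-! ### The named facts -/

/-- **Varesco 2025, Theorem 0.2 = Theorem 4.3 — in a four-dimensional family of K3 surfaces whose
general fibre has Picard number `16` and transcendental lattice `U_ℚ² ⊕ ⟨a⟩ ⊕ ⟨b⟩` (`a, b < 0`) and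
all of whose fibres have an algebraic Kuga–Satake correspondence, every power of every fibre has all
its Hodge classes algebraic.** Verbatim: "Let `𝒳 → S` be a four-dimensional family of K3 surfaces
whose general fibre is of Picard number `16` with an isometry `T(𝒳_s) ≃ U_ℚ² ⊕ ⟨a⟩ ⊕ ⟨b⟩`, for some
negative integers `a` and `b`. If the Kuga–Satake correspondence is algebraic for the fibres of this
family, then the Hodge [statement] holds for all powers of every K3 surface in this family."
Rendering (module docstring): for `f : 𝒳 ⟶ S` an `IsK3Family f 4`, negative integers `a, b`, the
very general complex fibre (`IsVeryGeneralIn`: off a countable family of proper closed subsets of `S`)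
having `dim_ℂ N¹H² = 16` and `HasTranscendentalLatticeU2ab _ a b`, and EVERY complex fibre having an
algebraic Kuga–Satake correspondence (`IsKSCorrespondenceAlgebraicBetti`), every cartesian power
`(𝒳_s)ᵏ` of every complex fibre satisfies the tree's per-variety Hodge statement in dimension `k * 2`.
A THEOREM in print (status: proved; REFEREED: Michigan Math. J. 2025; unproved in the tree; printed
instances: the six-line double planes and the `15`-nodal quartics, Examples 4.4–4.5, not constructed in
the tree). [cite: Varesco2025, Thm. 0.2 (§0.2) = Thm. 4.3 (§4) with its proof (cases (i)–(iv)) and Examples 4.4–4.5]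
[cite: Schlickewei2010, Introduction (the square of the six-line double planes)] [cite: Lombardo2001, Thm. (Kuga–Satake varieties of rank-6 K3-type structures = powers of Weil fourfolds)] -/
def Varesco2025_hodgeClasses_algebraic_powers_picardSixteenFamily : Prop :=
  ∀ ⦃𝒳 S : Motives.SchemeOver ℂ⦄ (f : 𝒳 ⟶ S) (hf : IsK3Family f 4) (a b : ℤ), a < 0 → b < 0 →
    IsVeryGeneralIn S (fun s =>
      Module.finrank ℂ ↥(algebraicClasses (fiberOver f s) 1) = 16 ∧
        HasTranscendentalLatticeU2ab (fiberOver f s) a b) →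
    (∀ s : Motives.ComplexPoints S,
      IsKSCorrespondenceAlgebraicBetti (hf.isK3Surface s).isSmoothProjective) →
    ∀ (s : Motives.ComplexPoints S) (k : ℕ),
      HodgeConjectureFor (k * 2) (Motives.SchemeOver.pow (fiberOver f s) k)

namespace Varesco2025_hodgeClasses_algebraic_powers_picardSixteenFamily

/-- **The square**: under the hypotheses of Thm. 4.3, `𝒳_s × 𝒳_s` (`= (𝒳_s)²`, dimension `4`)
satisfies the Hodge statement for every complex fibre — the form consumed by the K3-square routes
(Schlickewei's theorem for the six-line family is the printed instance).
[cite: Varesco2025, Thm. 4.3 (§4) and Example 4.4] [cite: Schlickewei2010, Introduction] -/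
theorem square (h : Varesco2025_hodgeClasses_algebraic_powers_picardSixteenFamily)
    {𝒳 S : Motives.SchemeOver ℂ} (f : 𝒳 ⟶ S) (hf : IsK3Family f 4) {a b : ℤ} (ha : a < 0) (hb : b < 0)
    (hgen : IsVeryGeneralIn S (fun s =>
      Module.finrank ℂ ↥(algebraicClasses (fiberOver f s) 1) = 16 ∧
        HasTranscendentalLatticeU2ab (fiberOver f s) a b))
    (hKS : ∀ s : Motives.ComplexPoints S,
      IsKSCorrespondenceAlgebraicBetti (hf.isK3Surface s).isSmoothProjective)
    (s : Motives.ComplexPoints S) :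
    HodgeConjectureFor 4 (Motives.SchemeOver.pow (fiberOver f s) 2) :=
  h f hf a b ha hb hgen hKS s 2

end Varesco2025_hodgeClasses_algebraic_powers_picardSixteenFamily

/-- **Varesco 2025, Corollary 2.23 — algebraicity of all Hodge classes on all powers SPECIALISES from
the general fibre of a family of K3 surfaces to any fibre with `End_Hdg T = ℚ`.** Verbatim: "Let
`𝒳 → S` be a family of K3 surfaces such that the Hodge [statement] for all powers of `𝒳_s` holds for
general `s ∈ S`. If `0 ∈ S` is an element such that `End_{Hdg(𝒳_0)}(T(𝒳_0)) = ℚ`, then the Hodge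
[statement] holds for all powers of `𝒳_0`." (Printed proof: Prop. 2.22 — algebraicity of `det T(𝒳_s)`
is a closed property in families — and Thm. 2.16.) Rendering (module docstring): for `f : 𝒳 ⟶ S` an
`IsK3Family f d` (any `d`), if very generally in `s ∈ S(ℂ)` every power `(𝒳_s)ᵏ` satisfies the
tree's per-variety Hodge statement, then so does every power of every complex fibre `𝒳_{s₀}` with
`HasRationalTranscendentalEndomorphismsOnly (𝒳_{s₀})`. A THEOREM in print (status: proved; REFEREED;
unproved in the tree). [cite: Varesco2025, Cor. 2.23 with Prop. 2.22 and Thm. 2.16 (§2.4)] -/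
def Varesco2025_hodgeClasses_algebraic_powers_specialisation : Prop :=
  ∀ ⦃𝒳 S : Motives.SchemeOver ℂ⦄ (f : 𝒳 ⟶ S) (d : ℕ), IsK3Family f d →
    IsVeryGeneralIn S (fun s =>
      ∀ k : ℕ, HodgeConjectureFor (k * 2) (Motives.SchemeOver.pow (fiberOver f s) k)) →
    ∀ s₀ : Motives.ComplexPoints S, HasRationalTranscendentalEndomorphismsOnly (fiberOver f s₀) →
      ∀ k : ℕ, HodgeConjectureFor (k * 2) (Motives.SchemeOver.pow (fiberOver f s₀) k)

namespace Varesco2025_hodgeClasses_algebraic_powers_specialisation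

/-- **Consequence: in a family of K3 surfaces in which very generally all powers satisfy the Hodge
statement, it holds for all powers of EVERY fibre whose transcendental endomorphism field is `ℚ`** —
in particular for every fibre once all fibres have `End_Hdg T = ℚ`.
[cite: Varesco2025, Cor. 2.23 (§2.4)] -/
theorem forall_of_forall_rational (h : Varesco2025_hodgeClasses_algebraic_powers_specialisation)
    {𝒳 S : Motives.SchemeOver ℂ} (f : 𝒳 ⟶ S) {d : ℕ} (hf : IsK3Family f d)
    (hgen : IsVeryGeneralIn S (fun s =>
      ∀ k : ℕ, HodgeConjectureFor (k * 2) (Motives.SchemeOver.pow (fiberOver f s) k)))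
    (hQ : ∀ s : Motives.ComplexPoints S, HasRationalTranscendentalEndomorphismsOnly (fiberOver f s))
    (s : Motives.ComplexPoints S) (k : ℕ) :
    HodgeConjectureFor (k * 2) (Motives.SchemeOver.pow (fiberOver f s) k) :=
  h f d hf hgen s (hQ s) k

end Varesco2025_hodgeClasses_algebraic_powers_specialisation

/-! ### Bridge: "very general" as a residual (comeagre) property of `S(ℂ)` (appended 2026-08-27)

The cell's planner idiom (ROUTE-P1K §2A) reads "the very general fibre satisfies `P`" as
`∀ᶠ s in residual S(ℂ), P s` (Mathlib's `residual` filter on the analytic topology). For `S`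
irreducible, separated and locally of finite type over `ℂ` this FOLLOWS from `IsVeryGeneralIn S P`:
the complex points off one proper Zariski-closed subset form a dense open subset of `S(ℂ)` (Serre,
GAGA Prop. 5 — the tree's `Motives.ComplexPoints.dense_setOf_pt_not_mem`), and a countable
intersection of dense open sets is residual. -/

/-- The complex points off a proper Zariski-closed subset of an irreducible `S` form a residual subset
of `S(ℂ)` (dense open). [cite: SerreGAGA1956, §2 n°7 Prop. 5] [cite: VoisinHodgeII2003, §3.3.1] -/
theorem setOf_pt_not_mem_mem_residual {S : Motives.SchemeOver ℂ} [LocallyOfFiniteType S.hom]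
    [IrreducibleSpace S.left] {C : Set S.left} (hC : IsClosed C) (hCne : C ≠ Set.univ) :
    {s : Motives.ComplexPoints S | s.pt ∉ C} ∈ residual (Motives.ComplexPoints S) :=
  residual_of_dense_open
    (Motives.AlgPoints.isOpen_setOf_pt_mem (X := S) (L := ℂ) ⟨Cᶜ, hC.isOpen_compl⟩)
    (Motives.ComplexPoints.dense_setOf_pt_not_mem hC hCne)

/-- **`IsVeryGeneralIn S P` ⇒ `P` holds on a residual set of complex points** (`S` irreducible,
separated, locally of finite type over `ℂ`): the planner idiom `∀ᶠ s in residual S(ℂ), P s`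
(ROUTE-P1K `VeryGeneralFibre`) follows from the Zariski form used in the records above.
[cite: VoisinHodgeII2003, §3.3.1 (a general point: outside a countable union of proper algebraic subsets)]
[cite: SerreGAGA1956, §2 n°7 Prop. 5] -/
theorem IsVeryGeneralIn.eventually_residual {S : Motives.SchemeOver ℂ} [LocallyOfFiniteType S.hom]
    [IrreducibleSpace S.left] {P : Motives.ComplexPoints S → Prop} (h : IsVeryGeneralIn S P) :
    ∀ᶠ s in residual (Motives.ComplexPoints S), P s := by
  obtain ⟨𝒵, h𝒵, hcl, hP⟩ := h
  have hmem : (⋂ Z ∈ 𝒵, {s : Motives.ComplexPoints S | s.pt ∉ Z}) ∈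
      residual (Motives.ComplexPoints S) :=
    (countable_bInter_mem h𝒵).2 fun Z hZ => setOf_pt_not_mem_mem_residual (hcl Z hZ).1 (hcl Z hZ).2
  refine Filter.mem_of_superset hmem fun s hs => hP s fun Z hZ => ?_
  exact (Set.mem_iInter₂.1 hs) Z hZ

/-- In particular, under the hypotheses of `Varesco2025_hodgeClasses_algebraic_powers_specialisation`
read in the residual idiom: if all powers of the fibres satisfy the Hodge statement very generally
(Zariski form), they do so for a residual set of `s ∈ S(ℂ)`. [cite: Varesco2025, Cor. 2.23 (§2.4)] -/
theorem IsVeryGeneralIn.eventually_residual_powers {𝒳 S : Motives.SchemeOver ℂ} (f : 𝒳 ⟶ S)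
    [LocallyOfFiniteType S.hom] [IrreducibleSpace S.left]
    (h : IsVeryGeneralIn S (fun s =>
      ∀ k : ℕ, HodgeConjectureFor (k * 2) (Motives.SchemeOver.pow (fiberOver f s) k))) :
    ∀ᶠ s in residual (Motives.ComplexPoints S),
      ∀ k : ℕ, HodgeConjectureFor (k * 2) (Motives.SchemeOver.pow (fiberOver f s) k) :=
  h.eventually_residual

end Literature.AlgebraicGeometry.Surfaces

end
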